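import Summits.Ventures.LatticeQCDFlow.Scaling.SwapAcceptanceMinLaw
import Summits.Ventures.LatticeQCDFlow.Scaling.GiniMeanDifferenceVarianceBounds
import Summits.Ventures.LatticeQCDFlow.Scaling.SwapLadderLogConcave
import Summits.Ventures.LatticeQCDFlow.Scaling.SwapAcceptanceMonotone

/-!
HONEST FRAMING: exact (Metropolis-corrected) sampling algorithms for lattice gauge theory; figures
of merit are autocorrelation/cost numbers at stated couplings and volumes; no continuum-physics
claim.

# SwapAcceptanceGapSlope — THE EXACT SWAP ACCEPTANCE LEAVES `1` LINEARLY IN THE GAP WITH SLOPE HALF THE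
# GINI MEAN DIFFERENCE OF THE TEMPERING STATISTIC: `d/dh swapAcc(s, s+h)|_{h=0⁺} = −½·E_{μ_s⊗μ_s}|X − X′|`,
# HENCE `|slope| ≤ σ_s(X)/√3` FOR EVERY BOUNDED LINEAR FAMILY (row 22 `su3-ptbc`, GEN-9, ours; sequel of
# `SwapAcceptanceMinLaw`, with row 3's `GiniMeanDifferenceVarianceBounds`)

Venture `LatticeQCDFlow` (cell pub-lqcd), topic `Scaling`; FANOUT row 22 (`su3-ptbc`, PTBC comparator arm
E4).  NEW WORK of the cell over row 22's GEN-8 `SwapAcceptanceMinLaw` (`swapAcc_eq_min_law`: for `s ≤ t`,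
`swapAcc X μ s t = E_{μ_s⊗μ_s}[e^{(t−s)·min(X₁,X₂)}] / E_{μ_s}[e^{(t−s)X}]`), lean-2's bounded linear family
`μ_u = μ.tilted (u·X)` (`Scaling/SwapAcceptanceLaw`: `swapAcc`, `integrable_exp_mul_of_bounded`,
`mem_interior_integrableExpSet_of_bounded`, `isProbabilityMeasure_tilted_mul`, `integrable_of_abs_le`), row 3's
`Scaling/GiniMeanDifferenceVarianceBounds` (`Theory2.integral_integral_min_eq_sub_half_abs`:
`∫∫ min = mean − ½∫∫|·−·|`; `Theory2.half_integral_abs_sub_le_sqrt_variance_div_three`: Glasser's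
`½·E|T − T′| ≤ √(Var T/3)`), GEN-4's Gaussian swap model `gaussAcc ℓ = erfc(ℓ/(2√2))` (`Scaling/SwapLadderLogConcave`)
and `hasDerivAt_erfc` (`Scaling/SwapSpacingOptimum`); Mathlib `ProbabilityTheory.hasDerivAt_mgf`, `mgf_zero`,
`HasDerivAt.div`, `HasDerivWithinAt.congr`, `hasDerivWithinAt_iff_tendsto_slope`, `analyticOnNhd_mgf`,
`intermediate_value_Icc'`, `integral_prod`, `memLp_of_bounded`; GEN-8's `SwapAcceptanceMonotone.swapAcc_self`.  Nothing is cited as a fact; no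
numerics of a run.

## What is proved (`μ` a probability measure, `X` bounded measurable, `μ_s := μ.tilted (s·X)`)

* `swapAcc_eq_mgf_pairMin_div` — the min law in MGF vocabulary: for `0 ≤ h`,
  `swapAcc X μ s (s+h) = mgf(min(X₁,X₂); μ_s⊗μ_s)(h) / mgf(X; μ_s)(h)`.
* `hasDerivWithinAt_swapAcc_gap` — `h ↦ swapAcc X μ s (s+h)` has RIGHT derivative
  `E_{μ_s⊗μ_s}[min(X₁,X₂)] − E_{μ_s}[X]` at `h = 0` (both MGFs are differentiable with the means as
  derivatives and equal `1` at `0`; quotient rule; the min law holds on `[0, ∞)`).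
* **`hasDerivWithinAt_swapAcc_gap_gini`** — THE GAP SLOPE: the right derivative is
  `−½·∫∫|X x − X y| dμ_s dμ_s` — minus half the GINI MEAN DIFFERENCE of the tempering statistic under the
  replica's own law.  To first order in the gap the exact swap acceptance is `1 − (h/2)·E_{μ_s⊗μ_s}|X − X′|`,
  whatever the action and the base measure (the left derivative is `+` the same by `swapAcc_symm`: the
  acceptance has a CORNER at coincidence, not a smooth maximum, unless `X` is `μ_s`-a.s. constant).
* `tendsto_one_sub_swapAcc_div_gap` — the acceptance DEFICIT PER UNIT GAP `(1 − swapAcc(s, s+h))/h` tends to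
  `½·E_{μ_s⊗μ_s}|X − X′|` as `h ↓ 0` (the form a run reports).
* `continuousOn_swapAcc_gap`, **`exists_gap_of_target`** — the exact acceptance is CONTINUOUS in the gap on
  `[0, ∞)` (ratio of two analytic MGFs), so for every horizon `H ≥ 0` and every target `a ∈ [swapAcc(s, s+H), 1]`
  some gap `h ∈ [0, H]` achieves `swapAcc(s, s+h) = a` (IVT): the card's retune-by-bisection step (§1.6: move
  `c_{i+1}` at fixed `c_i` until the pair accepts `20 %`) HAS a solution whenever the target lies between the
  current pair's acceptance and `1` — exact, not only in the Gaussian model (uniqueness would follow from strict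
  monotonicity, not typed here; monotonicity itself is GEN-8's `swapAcc_anti_right`).
* **`half_gini_le_sqrt_variance_div_three`** — UNIVERSAL SLOPE BOUND `½·E|X − X′| ≤ σ_s(X)/√3` (Glasser, via
  row 3), so `swapAcc(s, s+h) ≥ 1 − h·σ_s/√3 + o(h)`.
* `hasDerivAt_gaussAcc_linear_gap` — the GAUSSIAN SWAP MODEL at first order: with the model gap
  `ℓ(h) = √2·σ·h` (`Var ΔS = h²(Var_s + Var_{s+h}) ∼ 2σ_s²h²`, `Scaling/SwapLogRatioMoments`),
  `h ↦ gaussAcc(√2·σ·h) = erfc(σh/2)` has slope `−σ/√π` at `0`.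
* **`half_gini_le_sqrt_pi_div_three_mul_model_slope`** — `½·E|X − X′| ≤ √(π/3)·(σ_s/√π)`: the exact first-order
  acceptance loss never exceeds the Gaussian model's by more than the factor `√(π/3) ≈ 1.023`; it CAN be
  arbitrarily smaller (a skewed two-point `X` has `½E|X−X′| = σ²/|a−b| → 0` at fixed `σ`), i.e. the Gaussian
  retune prediction of CARD §1.6 is, at small gaps, conservative to within `2.4 %` and otherwise optimistic
  only about how FAST acceptance is lost — never about the direction.

WHY (CARD-su3-ptbc §1.5–§1.6, the ladder-tuning levers).  GEN-8 closed the exactness side of the tuning rule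
(acceptance monotone in the gap; the min law).  This file is the first-order QUANTITATIVE statement that is
model-free: near coincidence the acceptance deficit per unit gap is half the Gini mean difference of the defect
action under the replica's law — a single-replica statistic (two U-statistics of one pilot run: `mean_{i<j}|x_i −
x_j|`), pinned to the familiar `σ` within `[0, 1/√3]` and, for near-Gaussian action histograms, close to the
model's `1/√π = 0.564`.  A successor with a run in hand can report `½·GMD/σ` per replica beside the Gaussian
retune prediction (report-only; no recipe byte changes).

Literature grade (cell rule): KNOWN MECHANISM (first-order expansion of exchange acceptances in the inverse-
temperature gap, e.g. Kofke 2002, Rathore–Chopra–de Pablo 2005, Predescu–Predescu–Ciobanu 2004 use the energy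
variance / heat capacity, i.e. the Gaussian `σ/√π` form), NEW TYPING (the exact Gini form at measure level for every
bounded linear family, with the universal `σ/√3` bound and the `√(π/3)` comparison).  presearch: row 3's
`IdentityFlowAcceptanceStrongCoupling` (GEN-17) is the same first-order mechanism for the untrained INDEPENDENCE
sampler in the coupling; this file is the replica-exchange counterpart in the gap.  NOT CLAIMED: the left
derivative / the corner as a theorem (only the right derivative is typed); second-order terms; strict monotonicity;
any number of a run.
-/

noncomputable section

open MeasureTheory ProbabilityTheory Real Set Filter Topology
open Literature.ComputerArithmetic.BrentZimmermann2010.AsymptoticExpansions (erfc)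

namespace Summit.Ventures.LatticeQCDFlow.Scaling

variable {Ω : Type*} [MeasurableSpace Ω] {μ : Measure Ω} [IsProbabilityMeasure μ] {X : Ω → ℝ}

omit [IsProbabilityMeasure μ] in
/-- The pair minimum `min(X z.1, X z.2)` on `Ω × Ω` is measurable. [folklore] -/
theorem measurable_pairMin (hXm : Measurable X) : Measurable fun z : Ω × Ω => min (X z.1) (X z.2) :=
  (hXm.comp measurable_fst).min (hXm.comp measurable_snd)

omit [MeasurableSpace Ω] [IsProbabilityMeasure μ] in
/-- The pair minimum inherits the bound of `X`. [folklore] -/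
theorem pairMin_bounded (hXb : ∃ C, ∀ ω, |X ω| ≤ C) :
    ∃ C, ∀ z : Ω × Ω, |min (X z.1) (X z.2)| ≤ C := by
  obtain ⟨C, hC⟩ := hXb
  refine ⟨C, fun z => ?_⟩
  rcases min_choice (X z.1) (X z.2) with h | h <;> rw [h] <;> exact hC _

/-- **Min law in MGF vocabulary**: for `0 ≤ h`,
`swapAcc X μ s (s + h) = mgf (pair min) (μ_s ⊗ μ_s) h / mgf X μ_s h`. [ours] -/
theorem swapAcc_eq_mgf_pairMin_div (hXm : Measurable X) (hXb : ∃ C, ∀ ω, |X ω| ≤ C) (s : ℝ) {h : ℝ}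
    (hh : 0 ≤ h) :
    swapAcc X μ s (s + h)
      = mgf (fun z : Ω × Ω => min (X z.1) (X z.2))
          ((μ.tilted fun ω => s * X ω).prod (μ.tilted fun ω => s * X ω)) h
        / mgf X (μ.tilted fun ω => s * X ω) h := by
  rw [swapAcc_eq_min_law hXm hXb (by linarith : s ≤ s + h), add_sub_cancel_left]
  rfl

/-- **THE GAP SLOPE (raw form).**  `h ↦ swapAcc X μ s (s + h)` has right derivative
`E_{μ_s⊗μ_s}[min(X₁,X₂)] − E_{μ_s}[X]` at `h = 0`. [ours] -/
theorem hasDerivWithinAt_swapAcc_gap (hXm : Measurable X) (hXb : ∃ C, ∀ ω, |X ω| ≤ C) (s : ℝ) :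
    HasDerivWithinAt (fun h => swapAcc X μ s (s + h))
      ((∫ z, min (X z.1) (X z.2) ∂((μ.tilted fun ω => s * X ω).prod (μ.tilted fun ω => s * X ω)))
        - ∫ ω, X ω ∂(μ.tilted fun ω => s * X ω)) (Ici 0) 0 := by
  set μs : Measure Ω := μ.tilted fun ω => s * X ω with hμs
  haveI : IsProbabilityMeasure μs := isProbabilityMeasure_tilted_mul hXm hXb s
  set Y : Ω × Ω → ℝ := fun z => min (X z.1) (X z.2) with hY
  have hYm : Measurable Y := measurable_pairMin hXm
  have hYb : ∃ C, ∀ z, |Y z| ≤ C := pairMin_bounded hXb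
  -- the two MGFs are differentiable at `0` with the means as derivatives
  have hN : HasDerivAt (mgf Y (μs.prod μs)) (∫ z, Y z ∂(μs.prod μs)) 0 := by
    have h := hasDerivAt_mgf (mem_interior_integrableExpSet_of_bounded hYm hYb (μ := μs.prod μs) 0)
    simpa using h
  have hD : HasDerivAt (mgf X μs) (∫ ω, X ω ∂μs) 0 := by
    have h := hasDerivAt_mgf (mem_interior_integrableExpSet_of_bounded hXm hXb (μ := μs) 0)
    simpa using h
  have hN0 : mgf Y (μs.prod μs) 0 = 1 := by simp
  have hD0 : mgf X μs 0 = 1 := by simp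
  have hQ : HasDerivAt (fun h => mgf Y (μs.prod μs) h / mgf X μs h)
      ((∫ z, Y z ∂(μs.prod μs)) - ∫ ω, X ω ∂μs) 0 := by
    have h := hN.div hD (by rw [hD0]; exact one_ne_zero)
    rw [hN0, hD0, mul_one, one_mul, one_pow, div_one] at h
    exact h
  refine hQ.hasDerivWithinAt.congr (fun h hh => ?_) ?_
  · exact swapAcc_eq_mgf_pairMin_div hXm hXb s hh
  · exact swapAcc_eq_mgf_pairMin_div hXm hXb s le_rfl

/-- **THE GAP SLOPE IS MINUS HALF THE GINI MEAN DIFFERENCE.**  `h ↦ swapAcc X μ s (s + h)` has right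
derivative `−½·∫∫ |X x − X y| dμ_s dμ_s` at `h = 0`: to first order in the gap the exact swap acceptance is
`1 − (h/2)·E_{μ_s⊗μ_s}|X − X′|`, whatever the action. [ours] -/
theorem hasDerivWithinAt_swapAcc_gap_gini (hXm : Measurable X) (hXb : ∃ C, ∀ ω, |X ω| ≤ C) (s : ℝ) :
    HasDerivWithinAt (fun h => swapAcc X μ s (s + h))
      (-(1 / 2 * ∫ x, ∫ y, |X x - X y| ∂(μ.tilted fun ω => s * X ω) ∂(μ.tilted fun ω => s * X ω)))
      (Ici 0) 0 := by
  set μs : Measure Ω := μ.tilted fun ω => s * X ω with hμs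
  haveI : IsProbabilityMeasure μs := isProbabilityMeasure_tilted_mul hXm hXb s
  have hXi : Integrable X μs := by
    obtain ⟨C, hC⟩ := hXb
    exact integrable_of_abs_le hXm hC
  have h := hasDerivWithinAt_swapAcc_gap (μ := μ) hXm hXb s
  obtain ⟨C', hC'⟩ := pairMin_bounded (X := X) hXb
  have hprod : ∫ z, min (X z.1) (X z.2) ∂(μs.prod μs) = ∫ x, ∫ y, min (X x) (X y) ∂μs ∂μs :=
    integral_prod _ (integrable_of_abs_le (measurable_pairMin hXm) hC')
  rw [← hμs, hprod, Theory2.integral_integral_min_eq_sub_half_abs hXi] at h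
  convert h using 1
  ring

/-- **The acceptance deficit per unit gap tends to half the Gini mean difference**:
`(1 − swapAcc X μ s (s+h))/h → ½·E_{μ_s⊗μ_s}|X − X′|` as `h ↓ 0`. [ours] -/
theorem tendsto_one_sub_swapAcc_div_gap (hXm : Measurable X) (hXb : ∃ C, ∀ ω, |X ω| ≤ C) (s : ℝ) :
    Tendsto (fun h => (1 - swapAcc X μ s (s + h)) / h) (𝓝[>] 0)
      (𝓝 (1 / 2 * ∫ x, ∫ y, |X x - X y| ∂(μ.tilted fun ω => s * X ω) ∂(μ.tilted fun ω => s * X ω))) := by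
  have h := (hasDerivWithinAt_swapAcc_gap_gini (μ := μ) hXm hXb s)
  rw [hasDerivWithinAt_iff_tendsto_slope] at h
  have h0 : swapAcc X μ s (s + 0) = 1 := by rw [add_zero]; exact swapAcc_self hXm hXb s
  have hset : Ici (0 : ℝ) \ {0} = Ioi 0 := Ici_sdiff_left
  rw [hset] at h
  have h' := h.neg
  rw [neg_neg] at h'
  refine h'.congr' (eventually_nhdsWithin_of_forall fun x hx => ?_)
  rw [slope_def_field, h0]
  ring

/-- **UNIVERSAL SLOPE BOUND**: the magnitude of the gap slope is at most `σ_s(X)/√3`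
(`½·E|X − X′| ≤ √(Var/3)`, row 3's Glasser bound). [ours] -/
theorem half_gini_le_sqrt_variance_div_three (hXm : Measurable X) (hXb : ∃ C, ∀ ω, |X ω| ≤ C) (s : ℝ) :
    1 / 2 * ∫ x, ∫ y, |X x - X y| ∂(μ.tilted fun ω => s * X ω) ∂(μ.tilted fun ω => s * X ω)
      ≤ Real.sqrt (variance X (μ.tilted fun ω => s * X ω) / 3) := by
  set μs : Measure Ω := μ.tilted fun ω => s * X ω with hμs
  haveI : IsProbabilityMeasure μs := isProbabilityMeasure_tilted_mul hXm hXb s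
  obtain ⟨C, hC⟩ := hXb
  have hX2 : MemLp X 2 μs :=
    memLp_of_bounded (a := -C) (b := C) (ae_of_all _ fun ω => abs_le.1 (hC ω)) hXm.aestronglyMeasurable 2
  exact Theory2.half_integral_abs_sub_le_sqrt_variance_div_three hXm hX2 (C := -C - 1)
    fun x => by linarith [(abs_le.1 (hC x)).1]

/-! ## Continuity in the gap and existence of the retune solution -/

/-- **The exact swap acceptance is CONTINUOUS in the gap** on `[0, ∞)` (ratio of two MGFs of bounded variables, each
analytic). [ours] -/
theorem continuousOn_swapAcc_gap (hXm : Measurable X) (hXb : ∃ C, ∀ ω, |X ω| ≤ C) (s : ℝ) :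
    ContinuousOn (fun h => swapAcc X μ s (s + h)) (Ici 0) := by
  set μs : Measure Ω := μ.tilted fun ω => s * X ω with hμs
  haveI : IsProbabilityMeasure μs := isProbabilityMeasure_tilted_mul hXm hXb s
  set Y : Ω × Ω → ℝ := fun z => min (X z.1) (X z.2) with hY
  have hYm : Measurable Y := measurable_pairMin hXm
  have hYb : ∃ C, ∀ z, |Y z| ≤ C := pairMin_bounded hXb
  have hN : Continuous (mgf Y (μs.prod μs)) := by
    refine continuous_iff_continuousAt.2 fun h => ?_
    exact (analyticOnNhd_mgf h (mem_interior_integrableExpSet_of_bounded hYm hYb h)).continuousAt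
  have hD : Continuous (mgf X μs) := by
    refine continuous_iff_continuousAt.2 fun h => ?_
    exact (analyticOnNhd_mgf h (mem_interior_integrableExpSet_of_bounded hXm hXb h)).continuousAt
  have hD0 : ∀ h, mgf X μs h ≠ 0 := fun h => (mgf_pos_of_bounded hXm hXb h).ne'
  have hQ : Continuous fun h => mgf Y (μs.prod μs) h / mgf X μs h := hN.div hD hD0
  refine hQ.continuousOn.congr fun h hh => ?_
  exact swapAcc_eq_mgf_pairMin_div hXm hXb s hh

/-- **EXISTENCE OF THE RETUNE SOLUTION** (CARD §1.6 bisection step, exact setting): for every horizon `H ≥ 0` and every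
target acceptance `a` between `swapAcc(s, s+H)` and `1` there is a gap `h ∈ [0, H]` with `swapAcc(s, s+h) = a`
(intermediate value theorem; `swapAcc(s, s) = 1`). [ours] -/
theorem exists_gap_of_target (hXm : Measurable X) (hXb : ∃ C, ∀ ω, |X ω| ≤ C) (s : ℝ) {H a : ℝ} (hH : 0 ≤ H)
    (ha : a ∈ Icc (swapAcc X μ s (s + H)) 1) : ∃ h ∈ Icc 0 H, swapAcc X μ s (s + h) = a := by
  have hcont : ContinuousOn (fun h => swapAcc X μ s (s + h)) (Icc 0 H) :=
    (continuousOn_swapAcc_gap hXm hXb s).mono Icc_subset_Ici_self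
  have h0 : swapAcc X μ s (s + 0) = 1 := by rw [add_zero]; exact swapAcc_self hXm hXb s
  have hivt := intermediate_value_Icc' hH hcont
  rw [h0] at hivt
  exact hivt ha

/-! ## The Gaussian swap model at first order -/

/-- **The Gaussian swap model's gap slope is `−σ/√π`**: with `ℓ(h) = √2·σ·h` the model stiffness gap of
`SwapLogRatioMoments` to first order (`Var ΔS = h²(Var_s + Var_{s+h}) ∼ 2σ_s²h²`), `h ↦ gaussAcc(√2·σ·h) =
erfc(σh/2)` has derivative `−σ/√π` at `h = 0`. [ours] -/
theorem hasDerivAt_gaussAcc_linear_gap (σ : ℝ) :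
    HasDerivAt (fun h => gaussAcc (sqrt 2 * σ * h)) (-(σ / sqrt π)) 0 := by
  have h2 : (0 : ℝ) < sqrt 2 := sqrt_pos.2 (by norm_num)
  have hlin : HasDerivAt (fun h : ℝ => sqrt 2 * σ * h / (2 * sqrt 2)) (sqrt 2 * σ / (2 * sqrt 2)) 0 := by
    simpa using ((hasDerivAt_id (0 : ℝ)).const_mul (sqrt 2 * σ)).div_const (2 * sqrt 2)
  have herfc := hasDerivAt_erfc (sqrt 2 * σ * 0 / (2 * sqrt 2))
  have hcomp : HasDerivAt (fun h : ℝ => gaussAcc (sqrt 2 * σ * h))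
      (-(2 / sqrt π * exp (-((sqrt 2 * σ * 0 / (2 * sqrt 2)) ^ 2))) * (sqrt 2 * σ / (2 * sqrt 2))) 0 :=
    herfc.comp (0 : ℝ) hlin
  refine hcomp.congr_deriv ?_
  rw [mul_zero, zero_div, show -((0 : ℝ) ^ 2) = 0 by norm_num, exp_zero, mul_one]
  field_simp

/-- **THE GAUSSIAN MODEL NEVER UNDERSTATES THE FIRST-ORDER ACCEPTANCE LOSS BY MORE THAN THE FACTOR `√(π/3)`**
(`≈ 1.023`): `½·E_{μ_s⊗μ_s}|X − X′| ≤ √(π/3)·(σ_s/√π)`; the exact slope can be arbitrarily SMALLER than the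
model's (skewed two-point laws), never more than `2.4 %` larger. [ours] -/
theorem half_gini_le_sqrt_pi_div_three_mul_model_slope (hXm : Measurable X) (hXb : ∃ C, ∀ ω, |X ω| ≤ C)
    (s : ℝ) :
    1 / 2 * ∫ x, ∫ y, |X x - X y| ∂(μ.tilted fun ω => s * X ω) ∂(μ.tilted fun ω => s * X ω)
      ≤ Real.sqrt (π / 3) * (Real.sqrt (variance X (μ.tilted fun ω => s * X ω)) / Real.sqrt π) := by
  have h := half_gini_le_sqrt_variance_div_three (μ := μ) hXm hXb s
  have hπ : 0 < π := pi_pos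
  have hV : 0 ≤ variance X (μ.tilted fun ω => s * X ω) := variance_nonneg _ _
  have hsπ : Real.sqrt π ≠ 0 := (sqrt_pos.2 hπ).ne'
  calc _ ≤ Real.sqrt (variance X (μ.tilted fun ω => s * X ω) / 3) := h
    _ = Real.sqrt (π / 3) * (Real.sqrt (variance X (μ.tilted fun ω => s * X ω)) / Real.sqrt π) := by
        rw [Real.sqrt_div hπ.le, Real.sqrt_div hV]
        field_simp

end Summit.Ventures.LatticeQCDFlow.Scaling

end
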